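/-
Copyright (c) 2026 the pub-hodgecm-mathlib formalisation cell (harness21).  Prover seat hodgecm-mathlib-LH10-p02 (g14), 2026-09-03.  E1 row 55 «HOROCYCLE ∕ HEIGHT
GEOMETRY OF THE U(3) TREE AT THE DATUM», file A-I-3 «HOROCYCLE STEPS: THE END AND THE STAR DICHOTOMY» (the head) (keeper F0P3a-p03 (g30) 03:20:54Z; census `CENSUS-R55.v1` c3e3dfd81a9bbf59).
-/
import Literature.NumberTheory.Automorphic.UnitaryLatticeTreeHorocycleTypeTwoStar   -- A-I-2 (this seat): (H3); brings A-I-1 ((T), (T′), (H2)), ★ 39γ, ★ `unipotentU ∕ torusU`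
import HarnessLib

/-!
# Horocycle steps of the unramified `U(3)` tree, III (the head): `N` FIXES THE END `A(−∞)`, and THE STAR DICHOTOMY AT EVERY APARTMENT VERTEX —
# a neighbour of `A j` is `A (j − 1)` or `n · A (j + 1)` with `n ∈ N ∩ Stab(A j)` (Bruhat–Tits 1972 §10, (4.4.4); Serre, *Trees* II.1.1, I.2; Rogawski 1990 §1.10, §4.5)

THE SETTING (common to the three files A-I-1∕2∕3).  `K` a valued field, `σ` an isometric involution, `ϖ` a `σ`-fixed uniformiser (`hd`), `J₀ = antidiag(1,1,1)`, `U = U(σ, J₀)`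
acting on the lattice tree by ★ `latticeGraphIso`; `B ≥ T, N` the upper-triangular Borel subgroup of `U`, its diagonal torus and its unipotent radical (★ `UnitaryGroup.borelU ∕
torusU ∕ unipotentU`; `B` is the stabiliser of the isotropic line `K e₀`).  The standard apartment is the bi-infinite path `A : ℤ → 𝓥` (HYPOTHESIS-STYLE `(A, hA0, hA1)` exactly as in
★ `UnitaryLatticeTreeGeodesicApartment` §Enum, supplied by ★ `exists_apartmentEnum`): `A (2a) = latt diag(ϖ^a, 1, ϖ^{-a})` (self-dual), `A (2a+1) = latt diag(ϖ^{a+1}, 1, ϖ^{-a})`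
(type two).  Cell `pub/hodgecm-mathlib` (D-0151), crux H413 = `stmt-HodgeConjecture-24833`, lane `--supports`; E1 BRICK LEDGER row 55 «HOROCYCLE ∕ HEIGHT GEOMETRY OF THE `U(3)` TREE
AT THE DATUM» (keeper F0P3a-p03 (g30) 03:20:54Z), file A-I «HOROCYCLE STEPS» of `CENSUS-R55.v1` (c3e3dfd81a9bbf59; the missing brick H «the `N`-orbits are the horospheres and the
standard apartment is a transversal», heads (T)(T′)(H1)–(H4); (H5)–(H8) = file A-II `UnitaryLatticeTreeHorosphereTransversal`, LH5-p05 (g12)), cut in three by the 400-line rule: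
A-I-1 `…HorocycleRootStar` ((T)(T′)(H2)), A-I-2 `…HorocycleTypeTwoStar` ((H3)), A-I-3 `…HorocycleSteps` ((H1)(H4), the head).  Topic `NumberTheory/Automorphic`; namespace
`Literature.NumberTheory.Automorphic.UnitaryLatticeTree`.  THEOREMS ONLY (no definition, no instance, no notation, no named fact, no `sorry`).
HONEST LABEL: count-neutral generic lattice-tree layer at an UNRAMIFIED datum `hd : UnramifiedLocalConjDatum σ ϖ` ((R-SS) banked as a PAYDOWN-UNR road for K1 only; E1 =
PRINT); HC_CM is proved only modulo the 7 printed citations (2 remaining named inputs hLiu418 = `stmt-HodgeConjecture-24832`, h413 = `stmt-HodgeConjecture-24833`) until rung 0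
closes; nothing printed is asserted here — elementary lattice algebra over a valued field.

THIS FILE.
* §1 **(H1)** `exists_forall_le_latticeGraphIso_apartmentEnum_eq_self_of_mem_unipotentU`: every `n ∈ N` fixes `A j` for all `j ≤ j₀(n)` — the entries of
  `diag(ϖ^{e₀},1,ϖ^{e₂})⁻¹ · n⁻¹ · diag(ϖ^{e₀},1,ϖ^{e₂})` above the diagonal are `n⁻¹₀₁ ϖ^{-e₀}`, `n⁻¹₀₂ ϖ^{e₂-e₀}`, `n⁻¹₁₂ ϖ^{e₂}` with `e₀ → −∞`, `e₂ → +∞`; so the `N`-horocycles are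
  centred at the end `lim_{j → −∞} A j`.  Helpers: `exists_forall_le_v_le_v_zpow` (every value is eventually `≤ |ϖ^a|`, `a → −∞`), `mulVec_of_mem_unipotentU`, `v_zpow_mul_v_zpow`.
* §4 **(H4) THE HEAD** `eq_apartmentEnum_sub_one_or_exists_mem_unipotentU_of_adj`: a neighbour `y` of `A j` is `A (j − 1)` or `n · A (j + 1)` with `n ∈ N` fixing `A j` — (H2)∕(H3)
  translated by the torus element `t_c` of (T), which normalises `N`.  Hence `N ∩ Stab(A j)` is transitive on the `q³` resp. `q` neighbours of `A j` other than `A (j−1)`; file A-II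
  (LH5-p05) turns (T)(T′)(H1)(H4) into «every vertex ∕ edge is `n · A j` ∕ `n · {A j, A (j+1)}` for a unique `j`».

## References
* [BruhatTits1972] F. Bruhat, J. Tits, *Groupes réductifs sur un corps local I*, Publ. Math. IHÉS 41 (1972), §10 (lattice models of the rank-one unitary building), (4.4.4)
  (the stabiliser of a vertex is transitive on the chambers containing it), (7.4.18).
* [Serre1980Trees] J.-P. Serre, *Trees* (1980), Ch. II §1.1 (the tree of `SL₂`: lattices, the apartment of diagonal lattices, the action of unipotent matrices), Ch. I §2.
* [Rogawski1990] J. D. Rogawski, *Automorphic Representations of Unitary Groups in Three Variables*, Ann. of Math. Stud. 123 (1990), §1.10 p. 9 (`B = MN`, `N = {u(x, z)}`,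
  `d(α, β, ᾱ⁻¹)`), §4.5 p. 45 (Iwasawa decomposition).
-/

set_option autoImplicit false

open scoped Valued WithZero Matrix MatrixGroups

namespace Literature.NumberTheory.Automorphic.UnitaryLatticeTree

open _root_.SimpleGraph Literature.NumberTheory.Automorphic Literature.NumberTheory.Automorphic.HermitianLattice
open Literature.NumberTheory.Automorphic.CartanUnique (uniformizer_ne_zero uniformizer_mem_integer)
open Literature.NumberTheory.Automorphic.UnitaryGroup

variable {K : Type*} [Field K] [Valued K ℤᵐ⁰] {σ : K →+* K} {ϖ : K}
section Enum

variable (hd : UnramifiedLocalConjDatum σ ϖ)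
  (A : ℤ → {M : Submodule 𝒪[K] (Fin 3 → K) // IsVertex σ ϖ ((StdForm.antidiagonal 3).over K) M})
  (hA0 : ∀ a : ℤ, (A (2 * a)).1 = latt (Matrix.diagonal ![ϖ ^ a, (1 : K), ϖ ^ (-a)]))
  (hA1 : ∀ a : ℤ, (A (2 * a + 1)).1 = latt (Matrix.diagonal ![ϖ ^ (a + 1), (1 : K), ϖ ^ (-a)]))
include hd hA0 hA1

/-! ## §1 `N` fixes the end `A(−∞)` of the apartment -/

omit hd hA0 hA1 in
/-- Every value is eventually below `|ϖ^a|` as `a → −∞`: `∃ m, ∀ a ≤ m, |x| ≤ |ϖ^a|`. [cite: Serre1980Trees, II.1.1] -/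
theorem exists_forall_le_v_le_v_zpow (hϖ : Valued.v ϖ = WithZero.exp (-1 : ℤ)) (x : K) : ∃ m : ℤ, ∀ a ≤ m, Valued.v x ≤ Valued.v (ϖ ^ a) := by
  by_cases hx : Valued.v x = 0
  · exact ⟨0, fun a _ => by rw [hx]; exact zero_le⟩
  · refine ⟨-Multiplicative.toAdd (WithZero.unzero hx), fun a ha => ?_⟩
    rw [CartanUnique.v_uniformizer_zpow hϖ, ← WithZero.coe_unzero hx]
    change (WithZero.exp (Multiplicative.toAdd (WithZero.unzero hx)) : ℤᵐ⁰) ≤ WithZero.exp (-a)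
    exact WithZero.exp_le_exp.2 (by omega)

omit [Valued K ℤᵐ⁰] hd hA0 hA1 in
/-- The action of an element of `N` (and of its inverse) on coordinates: `(u x)₀ = x₀ + u₀₁x₁ + u₀₂x₂`, `(u x)₁ = x₁ + u₁₂x₂`, `(u x)₂ = x₂`. [cite: Rogawski1990, §1.10 p. 9] -/
theorem mulVec_of_mem_unipotentU {u : unitaryGroupOfForm σ ((StdForm.antidiagonal 3).over K)} (hu : u ∈ unipotentU σ ((StdForm.antidiagonal 3).over K)) (x : Fin 3 → K) :
    ((u : GL (Fin 3) K) : Matrix (Fin 3) (Fin 3) K).mulVec x 0 =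
        x 0 + ((u : GL (Fin 3) K) : Matrix (Fin 3) (Fin 3) K) 0 1 * x 1 + ((u : GL (Fin 3) K) : Matrix (Fin 3) (Fin 3) K) 0 2 * x 2 ∧
      ((u : GL (Fin 3) K) : Matrix (Fin 3) (Fin 3) K).mulVec x 1 = x 1 + ((u : GL (Fin 3) K) : Matrix (Fin 3) (Fin 3) K) 1 2 * x 2 ∧
      ((u : GL (Fin 3) K) : Matrix (Fin 3) (Fin 3) K).mulVec x 2 = x 2 := by
  obtain ⟨hT, hdiag⟩ := (mem_unipotentU_iff u).1 hu
  have h10 : ((u : GL (Fin 3) K) : Matrix (Fin 3) (Fin 3) K) 1 0 = 0 := hT (show (id 0 : Fin 3) < id 1 by decide)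
  have h20 : ((u : GL (Fin 3) K) : Matrix (Fin 3) (Fin 3) K) 2 0 = 0 := hT (show (id 0 : Fin 3) < id 2 by decide)
  have h21 : ((u : GL (Fin 3) K) : Matrix (Fin 3) (Fin 3) K) 2 1 = 0 := hT (show (id 1 : Fin 3) < id 2 by decide)
  refine ⟨?_, ?_, ?_⟩ <;> simp only [Matrix.mulVec, dotProduct, Fin.sum_univ_three, h10, h20, h21, hdiag] <;> ring

omit hd hA0 hA1 in
/-- `|ϖ^m| · |ϖ^n| = |ϖ^(m+n)|`. [cite: Serre1980Trees, II.1.1] -/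
theorem v_zpow_mul_v_zpow (hϖ0 : ϖ ≠ 0) (m n : ℤ) : Valued.v (ϖ ^ m) * Valued.v (ϖ ^ n) = Valued.v (ϖ ^ (m + n)) := by
  rw [← map_mul, ← zpow_add₀ hϖ0]

/-- **`N` FIXES THE END `A(−∞)`**: every `n ∈ N` fixes all apartment vertices `A j`, `j ≤ j₀(n)` — the entries of `diag(ϖ^{e₀}, 1, ϖ^{e₂})⁻¹ · n⁻¹ · diag(ϖ^{e₀}, 1, ϖ^{e₂})` above the
diagonal are `n⁻¹₀₁ ϖ^{-e₀}`, `n⁻¹₀₂ ϖ^{e₂ - e₀}`, `n⁻¹₁₂ ϖ^{e₂}` with `e₀ → −∞`, `e₂ → +∞`.  So the horocycles of `N` are centred at the end `lim_{j → −∞} A j` (the isotropic line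
`K e₀` stabilised by `B`). [cite: Serre1980Trees, II.1.1] [cite: BruhatTits1972, §10] [cite: Rogawski1990, §1.10 p. 9] -/
theorem exists_forall_le_latticeGraphIso_apartmentEnum_eq_self_of_mem_unipotentU {n : unitaryGroupOfForm σ ((StdForm.antidiagonal 3).over K)}
    (hn : n ∈ unipotentU σ ((StdForm.antidiagonal 3).over K)) :
    ∃ j₀ : ℤ, ∀ j ≤ j₀, latticeGraphIso σ ϖ ((StdForm.antidiagonal 3).over K) n (A j) = A j := by
  have hϖ0 : ϖ ≠ 0 := uniformizer_ne_zero hd.vϖ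
  have hni : n⁻¹ ∈ unipotentU σ ((StdForm.antidiagonal 3).over K) := Subgroup.inv_mem _ hn
  set p : K := (((n⁻¹ : unitaryGroupOfForm σ ((StdForm.antidiagonal 3).over K)) : GL (Fin 3) K) : Matrix (Fin 3) (Fin 3) K) 0 1 with hp
  set q : K := (((n⁻¹ : unitaryGroupOfForm σ ((StdForm.antidiagonal 3).over K)) : GL (Fin 3) K) : Matrix (Fin 3) (Fin 3) K) 0 2 with hq
  set r : K := (((n⁻¹ : unitaryGroupOfForm σ ((StdForm.antidiagonal 3).over K)) : GL (Fin 3) K) : Matrix (Fin 3) (Fin 3) K) 1 2 with hr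
  obtain ⟨mp, hmp⟩ := exists_forall_le_v_le_v_zpow hd.vϖ p
  obtain ⟨mq, hmq⟩ := exists_forall_le_v_le_v_zpow hd.vϖ q
  obtain ⟨mr, hmr⟩ := exists_forall_le_v_le_v_zpow hd.vϖ r
  refine ⟨min (2 * mp - 3) (min (mq - 1) (2 * mr - 1)), fun j hj => ?_⟩
  have h1 : j ≤ 2 * mp - 3 := hj.trans (min_le_left _ _)
  have h2 : j ≤ mq - 1 := hj.trans ((min_le_right _ _).trans (min_le_left _ _))
  have h3 : j ≤ 2 * mr - 1 := hj.trans ((min_le_right _ _).trans (min_le_right _ _))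
  -- the even and odd vertices `A (2a) = latt diag(ϖ^a,1,ϖ^{-a})`, `A (2a+1) = latt diag(ϖ^{a+1},1,ϖ^{-a})` uniformly: `latt diag(ϖ^{e₀}, 1, ϖ^{e₂})`
  suffices key : ∀ e₀ e₂ : ℤ, Valued.v p ≤ Valued.v (ϖ ^ e₀) → Valued.v q ≤ Valued.v (ϖ ^ (e₀ - e₂)) → Valued.v r ≤ Valued.v (ϖ ^ (-e₂)) →
      mapGL (n : GL (Fin 3) K) (latt (Matrix.diagonal ![ϖ ^ e₀, (1 : K), ϖ ^ e₂])) = latt (Matrix.diagonal ![ϖ ^ e₀, (1 : K), ϖ ^ e₂]) by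
    apply Subtype.ext
    change mapGL (n : GL (Fin 3) K) (A j).1 = (A j).1
    obtain ⟨a, rfl | rfl⟩ := Int.even_or_odd' j
    · rw [hA0]
      exact key a (-a) (hmp a (by omega)) (hmq _ (by omega)) (hmr _ (by omega))
    · rw [hA1]
      exact key (a + 1) (-a) (hmp _ (by omega)) (hmq _ (by omega)) (hmr _ (by omega))
  intro e₀ e₂ hvp hvq hvr
  have hD : ∀ i, (![ϖ ^ e₀, (1 : K), ϖ ^ e₂] : Fin 3 → K) i ≠ 0 := by
    intro i; fin_cases i <;> simp [zpow_ne_zero _ hϖ0]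
  have hL : ∀ x : Fin 3 → K, x ∈ latt (Matrix.diagonal ![ϖ ^ e₀, (1 : K), ϖ ^ e₂]) ↔
      Valued.v (x 0) ≤ Valued.v (ϖ ^ e₀) ∧ Valued.v (x 1) ≤ 1 ∧ Valued.v (x 2) ≤ Valued.v (ϖ ^ e₂) := fun x => by
    rw [mem_latt_diagonal_iff hD, Fin.forall_fin_succ, Fin.forall_fin_two]
    simp only [Fin.succ_zero_eq_one, Fin.succ_one_eq_two, Matrix.cons_val_zero, Matrix.cons_val_one, Matrix.cons_val_two, Matrix.tail_cons, Matrix.head_cons, map_one]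
  -- the two mixed estimates
  have hqx : ∀ x₂ : K, Valued.v x₂ ≤ Valued.v (ϖ ^ e₂) → Valued.v (q * x₂) ≤ Valued.v (ϖ ^ e₀) := fun x₂ hx₂ => by
    rw [map_mul]
    calc Valued.v q * Valued.v x₂ ≤ Valued.v (ϖ ^ (e₀ - e₂)) * Valued.v (ϖ ^ e₂) := mul_le_mul' hvq hx₂
      _ = Valued.v (ϖ ^ e₀) := by rw [v_zpow_mul_v_zpow hϖ0, sub_add_cancel]
  have hrx : ∀ x₂ : K, Valued.v x₂ ≤ Valued.v (ϖ ^ e₂) → Valued.v (r * x₂) ≤ 1 := fun x₂ hx₂ => by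
    rw [map_mul]
    calc Valued.v r * Valued.v x₂ ≤ Valued.v (ϖ ^ (-e₂)) * Valued.v (ϖ ^ e₂) := mul_le_mul' hvr hx₂
      _ = 1 := by rw [v_zpow_mul_v_zpow hϖ0, neg_add_cancel, zpow_zero, map_one]
  have hpx : ∀ x₁ : K, Valued.v x₁ ≤ 1 → Valued.v (p * x₁) ≤ Valued.v (ϖ ^ e₀) := fun x₁ hx₁ => by
    rw [map_mul]
    calc Valued.v p * Valued.v x₁ ≤ Valued.v (ϖ ^ e₀) * 1 := mul_le_mul' hvp hx₁
      _ = Valued.v (ϖ ^ e₀) := mul_one _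
  ext x
  rw [mem_mapGL_iff, ← Subgroup.coe_inv, hL, hL]
  obtain ⟨e0, e1, e2⟩ := mulVec_of_mem_unipotentU hni x
  rw [e0, e1, e2, ← hp, ← hq, ← hr]
  constructor
  · rintro ⟨h0, h1', h2'⟩
    have hx1 : Valued.v (x 1) ≤ 1 := by
      rw [show x 1 = (x 1 + r * x 2) - r * x 2 by ring]; exact Valuation.map_sub_le _ h1' (hrx _ h2')
    refine ⟨?_, hx1, h2'⟩
    rw [show x 0 = (x 0 + p * x 1 + q * x 2) - p * x 1 - q * x 2 by ring]
    exact Valuation.map_sub_le _ (Valuation.map_sub_le _ h0 (hpx _ hx1)) (hqx _ h2')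
  · rintro ⟨h0, h1', h2'⟩
    exact ⟨Valuation.map_add_le _ (Valuation.map_add_le _ h0 (hpx _ h1')) (hqx _ h2'), Valuation.map_add_le _ h1' (hrx _ h2'), h2'⟩

/-! ## §4 The head: the star dichotomy at every apartment vertex -/

/-- **THE STAR DICHOTOMY AT EVERY APARTMENT VERTEX** (the horocycle step): a neighbour `y` of `A j` is EITHER the inward neighbour `A (j − 1)` OR `n · A (j + 1)` for some `n ∈ N`
fixing `A j`.  (Translate §2 ∕ §3 by the torus element `t_c` of §0, which normalises `N`.)  Consequently `N ∩ Stab(A j)` acts transitively on the neighbours of `A j` other than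
`A (j − 1)`, the `N`-orbits of vertices are the horospheres centred at `A(−∞)`, and (file A-II) every vertex is `n · A j` for a unique `j`.
[cite: BruhatTits1972, (4.4.4) and §10] [cite: Serre1980Trees, II.1.1] [cite: Rogawski1990, §1.10 p. 9; §4.5 p. 45] -/
theorem eq_apartmentEnum_sub_one_or_exists_mem_unipotentU_of_adj (j : ℤ)
    {y : {M : Submodule 𝒪[K] (Fin 3 → K) // IsVertex σ ϖ ((StdForm.antidiagonal 3).over K) M}}
    (hy : (latticeGraph σ ϖ ((StdForm.antidiagonal 3).over K)).Adj (A j) y) :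
    y = A (j - 1) ∨ ∃ n : unitaryGroupOfForm σ ((StdForm.antidiagonal 3).over K), n ∈ unipotentU σ ((StdForm.antidiagonal 3).over K) ∧
      latticeGraphIso σ ϖ ((StdForm.antidiagonal 3).over K) n (A j) = A j ∧ latticeGraphIso σ ϖ ((StdForm.antidiagonal 3).over K) n (A (j + 1)) = y := by
  -- reduce to a base vertex `A j₀`, `j₀ ∈ {0, −1}`, along the torus translation `t_c`
  suffices key : ∀ c j₀ : ℤ, (j₀ = 0 ∨ j₀ = -1) → j = j₀ + 2 * c →
      y = A (j - 1) ∨ ∃ n : unitaryGroupOfForm σ ((StdForm.antidiagonal 3).over K), n ∈ unipotentU σ ((StdForm.antidiagonal 3).over K) ∧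
        latticeGraphIso σ ϖ ((StdForm.antidiagonal 3).over K) n (A j) = A j ∧ latticeGraphIso σ ϖ ((StdForm.antidiagonal 3).over K) n (A (j + 1)) = y by
    obtain ⟨c, rfl | rfl⟩ := Int.even_or_odd' j
    · exact key c 0 (Or.inl rfl) (by ring)
    · exact key (c + 1) (-1) (Or.inr rfl) (by ring)
  intro c j₀ hj₀ hj
  obtain ⟨t, htT, -, htA⟩ := exists_mem_torusU_latticeGraphIso_apartmentEnum_eq_add hd A hA0 hA1 c
  set y₀ := latticeGraphIso σ ϖ ((StdForm.antidiagonal 3).over K) t⁻¹ y with hy₀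
  have hty₀ : latticeGraphIso σ ϖ ((StdForm.antidiagonal 3).over K) t y₀ = y := latticeGraphIso_mul_inv_apply t y
  have hadj : (latticeGraph σ ϖ ((StdForm.antidiagonal 3).over K)).Adj (A j₀) y₀ := by
    have h := hy
    rw [hj, ← htA j₀, ← hty₀] at h
    exact (latticeGraphIso σ ϖ ((StdForm.antidiagonal 3).over K) t).map_adj_iff.1 h
  -- the base step at `A 0` (§2) or `A (−1)` (§3)
  have base : y₀ = A (j₀ - 1) ∨ ∃ n : unitaryGroupOfForm σ ((StdForm.antidiagonal 3).over K), n ∈ unipotentU σ ((StdForm.antidiagonal 3).over K) ∧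
      latticeGraphIso σ ϖ ((StdForm.antidiagonal 3).over K) n (A j₀) = A j₀ ∧ latticeGraphIso σ ϖ ((StdForm.antidiagonal 3).over K) n (A (j₀ + 1)) = y₀ := by
    rcases hj₀ with rfl | rfl
    · by_cases h : y₀ = A (-1)
      · exact Or.inl (by rw [h]; norm_num)
      · obtain ⟨n, h1, h2, h3⟩ := exists_mem_unipotentU_apply_apartmentEnum_one_eq_of_adj_zero hd A hA0 hA1 hadj h
        exact Or.inr ⟨n, h1, h2, by rw [zero_add]; exact h3⟩
    · by_cases h : y₀ = A (-2)
      · exact Or.inl (by rw [h]; norm_num)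
      · obtain ⟨n, h1, h2, h3⟩ := exists_mem_unipotentU_apply_apartmentEnum_zero_eq_of_adj_neg_one hd A hA0 hA1 hadj h
        exact Or.inr ⟨n, h1, h2, by rw [show (-1 : ℤ) + 1 = 0 by norm_num]; exact h3⟩
  rcases base with h | ⟨n, hnN, hn0, hn1⟩
  · left
    rw [← hty₀, h, htA, hj]
    congr 1; ring
  · right
    refine ⟨t * n * t⁻¹, conj_mem_unipotentU_of_mem_torusU' htT hnN, ?_, ?_⟩
    · rw [hj, ← htA j₀, latticeGraphIso_mul_apply, latticeGraphIso_mul_apply, latticeGraphIso_inv_mul_apply, hn0]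
    · rw [hj, show j₀ + 2 * c + 1 = (j₀ + 1) + 2 * c by ring, ← htA (j₀ + 1), latticeGraphIso_mul_apply, latticeGraphIso_mul_apply,
        latticeGraphIso_inv_mul_apply, hn1, hty₀]

end Enum

end Literature.NumberTheory.Automorphic.UnitaryLatticeTree
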